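import Mathlib
import Literature.Computability.AlgebraicComplexity.BorderApolarityMembership
import Literature.Computability.Complexity.OccurrenceObstructionsBIP
import Literature.Computability.Complexity.OccurrenceObstructionsIPProofs
import Summits.ValiantsHypothesis.ValiantsHypothesis.Theorems.ValuativeGCTValuativeFlipPaddingLift
import Summits.ValiantsHypothesis.ValiantsHypothesis.Theorems.ValuativeGCTValuativeFlipInnerMonotone
import Summits.ValiantsHypothesis.ValiantsHypothesis.Theorems.ValuativeGCTValuativeFlipPerUniversalPrelims
import Summits.ValiantsHypothesis.ValiantsHypothesis.Theorems.ValuativeGCTValuativeFlipLiftSurjective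
import HarnessLib

/-!
# `ValuativeGCT.ValuativeFlip` (stmt-ValiantsHypothesis-12624): padded-permanent plethysm inheritance
# — the full inner plethysm of `Sym^δ Sym^k ℂ^{k²}` occurs in `ℂ[Δ_m(X₀₀^{m-N} per_N)]`, uniformly in `m`

Crux `ValuativeFlip` of route `ValuativeGCT` (wall-breaker decomposition k9/16, axis "explicit
padded-permanent highest-weight vectors for seedRichness", seat 3, 2026-08-16).  After the head of the
window (`n ≤ m ≤ 1.2n`, line `four-row-count`, all four head stubs landed) the crux is its tail
`stub_tailFlip = TailFlip`, whose every line needs a PER-SIDE lower bound for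
`mult_{λ*} ℂ[Δ_m(X₀₀^{m-n} per_n)]` on shapes of UNBOUNDED length, uniform in the padding.  This file
supplies that per-side half in closed form — plethysm currency — by making the padded permanent
UNIVERSAL for padded forms and feeding the all-forms padding lift of the tree:

* (prelims file `…PerUniversalPrelims.lean`) `exists_entryPer_eq_of_mem_homogeneousSubmodule` — every
  `p ∈ ℂ[x_σ]_k` is the permanent of an `N₀ × N₀` matrix of constants and variables,
  `N₀(σ, k) = 2 · #degMonomials(σ, k) · (k + #σ + 2) + 2` UNIFORM in `p` (monomial formula + Valiant's
  universality of the permanent, `BCS1997_thm_21_27_holds`); and `exists_linSubst_paddedPer_eq` — the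
  permanent twin of Mulmuley–Sohoni's homogenisation (`X_pow_mul_rename_mem_endOrbit_detPoly`) WITH a
  padding variable;
* `paddedForm_mem_endOrbit_paddedPerFormLex_of_perRepr`, `paddedForm_mem_orbitClosure_paddedPerFormLex`
  — hence for `N₀(k) := N₀(MatIdx k, k) ≤ N ≤ k + j`, `N₀(k) < k + j`, the padded form
  `X_top^j · f(x_segment)` of EVERY form `f` of degree `k` in the `k²` variables lies in
  `Δ_{k+j}(X₀₀^{k+j-N} per_N)` (`End · p ⊆ Δ(p)`, inner monotonicity `paddedPerFormLex_mem_orbitClosure_of_le`);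
* `plethysmCoeff_le_orbitMultiplicity_paddedPer_rowLift` — THE THEOREM: for every `λ ⊢ kδ` with at
  most `k²` parts, `a_λ(δ[k]) ≤ mult_{(λ♯(k+j))*} ℂ[Δ_{k+j}(X₀₀^{k+j-N} per_N)]` (the permanent twin of
  Ikenmeyer–Panova 2017 Prop. 2.6(b); via the landed `plethysmCoeff_le_orbitMultiplicity_rowLift_of_forall_mem`):
  every isotypic component of `Sym^δ(Sym^k ℂ^{k²})` occurs at the Kadish–Landsberg shape `λ + (jδ)` in
  the padded permanent's coordinate ring with its FULL plethysm multiplicity, uniformly in `j` and `N`;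
* `orbitMultiplicity_paddedPer_rowLift_eq_plethysmCoeff` — for `λ₂ ≤ k` (exact inner plethysm
  stability) the inequality is an EQUALITY: the padded permanent is plethysm-saturated at every stable
  liftable shape, so a flip there is equivalent to an equation of `Det_{k+j}` of that type;
* `flipBody_of_plethysmCensus` — so at every tail position `(N, m = k + j)` the flip body of the crux
  follows from a purely DETERMINANT-side census `dim T_U((λ♯m)) < a_λ(δ[k])`.

What remains of the crux on this axis (AXIS.md of the seat): exactly that det-side census in the
unstable range `kδ > m` (no small body), `ℓ(λ) → ∞` (bounded-length no-go), i.e. "valuative/symmetric-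
Kronecker census below a plethysm coefficient" — the open multiplicity problem; nothing per-side is
missing any more for shapes of length `≤ k²` once `N ≥ N₀(k)`.

Sources: L. G. Valiant, STOC 1979 §2; Bürgisser–Clausen–Shokrollahi 1997 Thm. (21.27);
Mulmuley–Sohoni, SIAM J. Comput. 31 (2001) Prop. 4.4; C. Ikenmeyer, G. Panova, Adv. Math. 319 (2017)
Prop. 2.6(b); P. Bürgisser, C. Ikenmeyer, G. Panova, J. AMS 32 (2019) Lemma 5.2, Thm. 5.4;
H. Kadish, J. M. Landsberg, Commun. Algebra 42 (2014) §1; BLMW, SIAM J. Comput. 40 (2011) §6.4.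
-/

-- `Summit.ValiantsHypothesis.ValiantsHypothesis.…` is the tree's mandated single-conjunct layout (Sub = Summit).
set_option linter.dupNamespace false

namespace Summit.ValiantsHypothesis.ValiantsHypothesis.Theorems.ValuativeFlip

open MvPolynomial
open scoped BigOperators
open Literature.NumberTheory.DiophantineGeometry
open Literature.Computability.AlgebraicComplexity
open Literature.Computability.Complexity

noncomputable section

/-- `#(MatIdx k) = k²`. [folklore] -/
theorem card_matIdx (k' : ℕ) : Fintype.card (MatIdx k') = k' * k' := by
  rw [show Fintype.card (MatIdx k') = Fintype.card (Fin k' × Fin k') from Fintype.card_lex _,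
    Fintype.card_prod, Fintype.card_fin]

/-- **Padded forms with an affine permanental representation of size `N` are `End`-instances of the
padded permanent `X₀₀^{k+j-N} per_N`.**  For a form `f` of degree `k` in the `k²` variables with
`f = per A`, `A` an `N × N` matrix (`k ≤ N < k + j`) of affine linear forms, the padded form
`X_top^j · f(x_segment) ∈ End · (X₀₀^{k+j-N} per_N)` inside `Sym^{k+j} ℂ^{(k+j)²}`: write the padded
permanent as `X₀₀^{k+j-N} · per_N(X_block)` (`paddedPerFormLex_eq`, `rename_perPoly_equiv`), and
substitute `X₀₀ ↦ X_top`, block entries `↦` the entries of `A` homogenised by `X_top` and placed on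
the final segment (`exists_linSubst_paddedPer_eq`); the padding variable `(0,0)` is off the bottom-right
block because `N < k + j`. [Mulmuley–Sohoni 2001 Prop. 4.4; Valiant 1979 §2; folklore] -/
theorem paddedForm_mem_endOrbit_paddedPerFormLex_of_perRepr {k' : ℕ} [NeZero k'] (j N : ℕ)
    [NeZero (k' + j)] (hkN : k' ≤ N) (hN : N < k' + j)
    {f : MvPolynomial (MatIdx k') ℂ} (hf : f.IsHomogeneous k')
    {n : Type*} [Fintype n] [DecidableEq n] (hn : Fintype.card n = N)
    (A : Matrix n n (MvPolynomial (MatIdx k') ℂ)) (hAdeg : ∀ i j, (A i j).totalDegree ≤ 1)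
    (hAper : A.permanent = f) :
    paddedForm k' j f ∈ endOrbit (MatIdx (k' + j)) ℂ (paddedPerFormLex ℂ N (k' + j)) := by
  classical
  have hNm : N ≤ k' + j := le_of_lt hN
  -- the bottom-right block, indexed by `n`
  let e : n ≃ BlockIdx N (k' + j) := Fintype.equivOfCardEq (by rw [hn, card_blockIdx hNm])
  let κ : n × n → MatIdx (k' + j) := fun ij =>
    toLex (((e ij.1 : BlockIdx N (k' + j)) : Fin (k' + j)), ((e ij.2 : BlockIdx N (k' + j)) : Fin (k' + j)))
  have hκ : Function.Injective κ := by
    intro a b hab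
    simp only [κ, toLex_inj, Prod.mk.injEq] at hab
    exact Prod.ext (e.injective (Subtype.ext hab.1)) (e.injective (Subtype.ext hab.2))
  have hz : (toLex ((0 : Fin (k' + j)), (0 : Fin (k' + j))) : MatIdx (k' + j)) ∉ Set.range κ := by
    rintro ⟨ij, hij⟩
    simp only [κ, toLex_inj, Prod.mk.injEq] at hij
    have h2 := (e ij.1).2
    have h1 : (((e ij.1 : BlockIdx N (k' + j)) : Fin (k' + j)) : ℕ) = 0 := by
      rw [hij.1]; rfl
    omega
  have hpp : paddedPerFormLex ℂ N (k' + j) =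
      X (toLex ((0 : Fin (k' + j)), (0 : Fin (k' + j)))) ^ (k' + j - N) * rename κ (perPoly n ℂ) := by
    rw [paddedPerFormLex_eq, ← rename_perPoly_equiv e, rename_rename]
    rfl
  obtain ⟨M, hM⟩ := exists_linSubst_paddedPer_eq hf (hn ▸ hkN) A hAdeg hAper κ hκ
    (toLex ((0 : Fin (k' + j)), (0 : Fin (k' + j)))) (topMatIdx (k' + j)) hz
    (segEmb (Nat.le_add_right k' j)) (k' + j - N)
  refine ⟨M, ?_⟩
  show linSubst _ ℂ M (paddedPerFormLex ℂ N (k' + j)) = paddedForm k' j f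
  rw [hpp, hM, paddedForm, hn]
  congr 2
  omega

/-- The same, as a membership in the orbit closure `Δ_{k+j}(X₀₀^{k+j-N} per_N)`
(`End · p ⊆ Δ(p)`, `endOrbit_subset_orbitClosure_holds`). [Mulmuley–Sohoni 2001 §4] -/
theorem paddedForm_mem_orbitClosure_paddedPerFormLex_of_perRepr {k' : ℕ} [NeZero k'] (j N : ℕ)
    [NeZero (k' + j)] (hkN : k' ≤ N) (hN : N < k' + j)
    {f : MvPolynomial (MatIdx k') ℂ} (hf : f.IsHomogeneous k')
    {n : Type*} [Fintype n] [DecidableEq n] (hn : Fintype.card n = N)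
    (A : Matrix n n (MvPolynomial (MatIdx k') ℂ)) (hAdeg : ∀ i j, (A i j).totalDegree ≤ 1)
    (hAper : A.permanent = f) :
    paddedForm k' j f ∈ orbitClosure (paddedPerFormLex ℂ N (k' + j)) :=
  endOrbit_subset_orbitClosure_holds _
    (paddedForm_mem_endOrbit_paddedPerFormLex_of_perRepr j N hkN hN hf hn A hAdeg hAper)

/-- `1 ≤ #degMonomials(MatIdx k, k)` (the monomial `X_top^k` has degree `k`). [folklore] -/
theorem one_le_card_degMonomials_matIdx (k' : ℕ) [NeZero k'] :
    1 ≤ (degMonomials (MatIdx k') k').card := by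
  classical
  refine Finset.card_pos.mpr ⟨Finsupp.single (topMatIdx k') k', ?_⟩
  rw [mem_degMonomials_iff, Finsupp.degree_single]

/-- **Universality of the padded permanent for padded forms** (Valiant's universality of the
permanent, made uniform in the form).  Put `N₀(k) = 2 · #degMonomials(MatIdx k, k) · (k² + k + 2) + 2`.
For every `N ≥ N₀(k)` and every padding `j` with `N₀(k) < k + j`, `N ≤ k + j`, the padded form
`X_top^j · f(x_segment)` of EVERY form `f` of degree `k` in the `k²` variables lies in
`Δ_{k+j}(X₀₀^{k+j-N} per_N)`: `f` has an affine permanental representation of size `N₀(k)`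
(`exists_entryPer_eq_of_mem_homogeneousSubmodule`), so the padded form is an `End`-instance of
`X₀₀^{k+j-N₀} per_{N₀}` (`paddedForm_mem_orbitClosure_paddedPerFormLex_of_perRepr`), which degenerates
from `X₀₀^{k+j-N} per_N` for `N₀ ≤ N ≤ k + j` (`paddedPerFormLex_mem_orbitClosure_of_le`).
[Valiant 1979 §2; BCS 1997 Thm. (21.27); Mulmuley–Sohoni 2001 Prop. 4.4; folklore] -/
theorem paddedForm_mem_orbitClosure_paddedPerFormLex {k' : ℕ} [NeZero k'] (j N : ℕ) [NeZero (k' + j)]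
    (hN₀ : 2 * ((degMonomials (MatIdx k') k').card * (k' + k' * k' + 2)) + 2 ≤ N)
    (hN₀' : 2 * ((degMonomials (MatIdx k') k').card * (k' + k' * k' + 2)) + 2 < k' + j)
    (hN : N ≤ k' + j) {f : MvPolynomial (MatIdx k') ℂ} (hf : f.IsHomogeneous k') :
    paddedForm k' j f ∈ orbitClosure (paddedPerFormLex ℂ N (k' + j)) := by
  classical
  obtain ⟨A₀, hA₀⟩ := exists_entryPer_eq_of_mem_homogeneousSubmodule k' f
    ((mem_homogeneousSubmodule k' f).mpr hf)
  have hNN : 2 * ((degMonomials (MatIdx k') k').card * (k' + Fintype.card (MatIdx k') + 2)) + 2 =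
      2 * ((degMonomials (MatIdx k') k').card * (k' + k' * k' + 2)) + 2 := by
    rw [card_matIdx]
  have hk₀ : k' ≤ 2 * ((degMonomials (MatIdx k') k').card * (k' + Fintype.card (MatIdx k') + 2)) + 2 := by
    have h1 : k' + Fintype.card (MatIdx k') + 2 ≤
        (degMonomials (MatIdx k') k').card * (k' + Fintype.card (MatIdx k') + 2) :=
      Nat.le_mul_of_pos_left _ (one_le_card_degMonomials_matIdx k')
    omega
  have hlt₀ : 2 * ((degMonomials (MatIdx k') k').card * (k' + Fintype.card (MatIdx k') + 2)) + 2 <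
      k' + j := by
    rw [hNN]; exact hN₀'
  have hle₀ : 2 * ((degMonomials (MatIdx k') k').card * (k' + Fintype.card (MatIdx k') + 2)) + 2 ≤
      N := by
    rw [hNN]; exact hN₀
  have hdeg : ∀ i i', ((A₀.map entryVal) i i').totalDegree ≤ 1 := by
    intro i i'
    rw [Matrix.map_apply]
    rcases A₀ i i' with c | x
    · rw [entryVal_inl, totalDegree_C]
      exact Nat.zero_le _
    · rw [entryVal_inr, totalDegree_X]
  have hmem₀ := paddedForm_mem_orbitClosure_paddedPerFormLex_of_perRepr j _ hk₀ hlt₀ hf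
    (Fintype.card_fin _) (A₀.map entryVal) hdeg hA₀
  exact orbitClosure_subset_of_mem_holds (paddedPerFormLex_mem_orbitClosure_of_le hle₀ hN) hmem₀

/-- **Padded-permanent plethysm inheritance (full inner plethysm, unbounded length).**
Let `k ≥ 1`, `N₀(k) = 2 · #degMonomials(MatIdx k, k) · (k² + k + 2) + 2`, `N₀(k) ≤ N ≤ k + j`,
`N₀(k) < k + j`.  Then for every degree `δ` and every partition `λ ⊢ kδ` with at most `k²` parts,

  `a_λ(δ[k]) = plethysmCoeff (MatIdx k) k λ* ≤ mult_{(λ♯(k+j))*} ℂ[Δ_{k+j}(X₀₀^{k+j-N} per_N)]`,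

i.e. every isotypic component of `Sym^δ(Sym^k ℂ^{k²})` occurs in the coordinate ring of the orbit
closure of the padded permanent at the row-lifted (Kadish–Landsberg) shape `λ♯(k+j) = λ + (jδ)`, with
at least its full plethysm multiplicity — uniformly in the padding `j` and the inner size `N`.  This is
the permanent twin of Ikenmeyer–Panova's Prop. 2.6(b) (`plethysmCoeff_le_orbitMultiplicity_rowLift`,
for `Δ(det_n)`): the all-forms padding lift `plethysmCoeff_le_orbitMultiplicity_rowLift_of_forall_mem`
(injectivity of the Kadish–Landsberg/BIP lifting modulo `I(Δ)` when ALL padded forms lie in `Δ`) fed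
with the universality of the padded permanent (`paddedForm_mem_orbitClosure_paddedPerFormLex`).
It is an explicit, `m`-uniform PER-SIDE lower bound on shapes of length up to `k²`, the per half of the
tail residual of crux `ValuativeFlip` in closed (plethysm) form; the det half — a valuative census
`dim T_U(λ♯m) < a_λ(δ[k])` in the unstable range `kδ > m` — is what remains open.
[Ikenmeyer–Panova 2017 Prop. 2.6(b); Bürgisser–Ikenmeyer–Panova 2019 Lemma 5.2, Thm. 5.4;
Kadish–Landsberg 2014 §1; Valiant 1979 §2; BLMW 2011 §6.4] -/
theorem plethysmCoeff_le_orbitMultiplicity_paddedPer_rowLift {k' : ℕ} [NeZero k'] (j N : ℕ)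
    [NeZero (k' + j)]
    (hN₀ : 2 * ((degMonomials (MatIdx k') k').card * (k' + k' * k' + 2)) + 2 ≤ N)
    (hN₀' : 2 * ((degMonomials (MatIdx k') k').card * (k' + k' * k' + 2)) + 2 < k' + j)
    (hN : N ≤ k' + j) {δ : ℕ} (lam : Nat.Partition (k' * δ)) (hlam : lam.parts.card ≤ k' * k') :
    plethysmCoeff ℂ (MatIdx k') k' (partitionWeightLex k' lam) ≤
      orbitMultiplicity ℂ (paddedPerFormLex ℂ N (k' + j)) (k' + j)
        (partitionWeightLex (k' + j) (rowLift lam j)) := by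
  have h0 : paddedPerFormLex ℂ N (k' + j) ≠ 0 := by
    intro h
    apply Literature.Computability.AlgebraicComplexity.BorderApolarity.paddedPerPoly_ne_zero N (k' + j)
    exact MvPolynomial.rename_injective _ toLex.injective (by rw [map_zero]; exact h)
  exact plethysmCoeff_le_orbitMultiplicity_rowLift_of_forall_mem j
    (paddedPerFormLex_isHomogeneous ℂ hN) h0 lam hlam
    (fun f hf => paddedForm_mem_orbitClosure_paddedPerFormLex j N hN₀ hN₀' hN hf)


/-- **Exact multiplicities of the padded permanent at stable liftable shapes.**  In the range of
`plethysmCoeff_le_orbitMultiplicity_paddedPer_rowLift` (`N₀(k) ≤ N ≤ k + j`, `N₀(k) < k + j`,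
`λ ⊢ kδ` with at most `k²` parts) and for `λ₂ ≤ k` (exact inner plethysm stability,
`plethysmCoeff_rowLift_eq`): `mult_{(λ♯(k+j))*} ℂ[Δ_{k+j}(X₀₀^{k+j-N} per_N)] = a_λ(δ[k])` EXACTLY —
the padded permanent is plethysm-saturated there (lower bound: this file; upper bound: BLMW's
plethysm bound `orbitMultiplicity_le_plethysmCoeff_holds` at level `k + j`).  Consequently a multiplicity
flip at such a shape is EQUIVALENT to an equation of `Det_{k+j}` of type `(λ♯(k+j))*` in degree `δ`.
[this file; BLMW 2011 Prop. 4.4.1; Bürgisser–Ikenmeyer–Panova 2019 Prop. 5.6(2)] -/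
theorem orbitMultiplicity_paddedPer_rowLift_eq_plethysmCoeff {k' : ℕ} [NeZero k'] (j N : ℕ)
    [NeZero (k' + j)]
    (hN₀ : 2 * ((degMonomials (MatIdx k') k').card * (k' + k' * k' + 2)) + 2 ≤ N)
    (hN₀' : 2 * ((degMonomials (MatIdx k') k').card * (k' + k' * k' + 2)) + 2 < k' + j)
    (hN : N ≤ k' + j) {δ : ℕ} (lam : Nat.Partition (k' * δ)) (hlam : lam.parts.card ≤ k' * k')
    (h₂ : lam.sortedParts.getD 1 0 ≤ k') :
    orbitMultiplicity ℂ (paddedPerFormLex ℂ N (k' + j)) (k' + j)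
        (partitionWeightLex (k' + j) (rowLift lam j)) =
      plethysmCoeff ℂ (MatIdx k') k' (partitionWeightLex k' lam) := by
  refine le_antisymm ?_ (plethysmCoeff_le_orbitMultiplicity_paddedPer_rowLift j N hN₀ hN₀' hN lam hlam)
  rw [← plethysmCoeff_rowLift_eq lam hlam h₂ j]
  exact orbitMultiplicity_le_plethysmCoeff_holds _ (NeZero.ne (k' + j))
    (paddedPerFormLex_isHomogeneous ℂ hN) _

/-- **The tail residual after the per side is paid in plethysm currency.**  At a window position
`(N, m)`, `m = k + j`, `N₀(k) ≤ N ≤ m`, `N₀(k) < m`: if some admissible centre `(U, r)` and some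
`λ ⊢ kδ` with at most `k²` parts have valuative truncation (verbatim the crux's `T_U`, at size `m`,
degree `δ`, weight `(λ♯m)*`) of dimension `< a_λ(δ[k])` — a PURELY DETERMINANT-SIDE census against
a plethysm coefficient — then the flip body of `ValuativeGCT.ValuativeFlip` / `TailFlip` holds at
`(N, m)` (verbatim: `∃ (U, r, δ, λ'), rank ≤ r ∧ ℓ(λ') ≤ m² ∧ dim T_U(λ') < mult_{λ'*} ℂ[Δ_m(X₀₀^{m-N} per_N)]`),
with `λ' = λ♯m`, by `plethysmCoeff_le_orbitMultiplicity_paddedPer_rowLift`.  This is what the axis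
"explicit padded-permanent highest-weight vectors" reduces the tail stub `stub_tailFlip` to.
[this file; Cruxes/ValuativeFlip/Lines/four_row_count.lean `stub_tailFlip`; Cruxes/TailFlip/Lines/Sketch.md item 3] -/
theorem flipBody_of_plethysmCensus {k' : ℕ} [NeZero k'] (j N : ℕ) [NeZero (k' + j)]
    (hN₀ : 2 * ((degMonomials (MatIdx k') k').card * (k' + k' * k' + 2)) + 2 ≤ N)
    (hN₀' : 2 * ((degMonomials (MatIdx k') k').card * (k' + k' * k' + 2)) + 2 < k' + j)
    (hN : N ≤ k' + j) {δ : ℕ} (lam : Nat.Partition (k' * δ)) (hlam : lam.parts.card ≤ k' * k')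
    (U : Submodule ℂ (MatIdx (k' + j) → ℂ)) (r : ℕ)
    (hU : ∀ u ∈ U, (Matrix.of fun a b : Fin (k' + j) => u (toLex (a, b))).rank ≤ r)
    (hcensus : Module.finrank ℂ ↥(MvPolynomial.homogeneousSubmodule (MatIdx (k' + j) × MatIdx (k' + j)) ℂ ((k' + j) * δ) ⊓
                ((MvPolynomial.vanishingIdeal ℂ
                    {p : MatIdx (k' + j) × MatIdx (k' + j) → ℂ | ∀ j' : MatIdx (k' + j), (fun i => p (j', i)) ∈ U}) ^ (δ * ((k' + j) - r))).restrictScalars ℂ ⊓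
                (⨅ (M : Matrix (MatIdx (k' + j)) (MatIdx (k' + j)) ℂ)
                  (_ : linSubst (MatIdx (k' + j)) ℂ M (detFormLex ℂ (k' + j)) = detFormLex ℂ (k' + j)),
                  LinearMap.ker ((MvPolynomial.aeval fun p : MatIdx (k' + j) × MatIdx (k' + j) =>
                      ∑ l : MatIdx (k' + j), M l p.2 •
                        (MvPolynomial.X (p.1, l) : MvPolynomial (MatIdx (k' + j) × MatIdx (k' + j)) ℂ)).toLinearMap -
                    (LinearMap.id : MvPolynomial (MatIdx (k' + j) × MatIdx (k' + j)) ℂ →ₗ[ℂ] MvPolynomial (MatIdx (k' + j) × MatIdx (k' + j)) ℂ))) ⊓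
                (⨅ (g : Matrix.GeneralLinearGroup (MatIdx (k' + j)) ℂ) (_ : IsUpperTriangular g),
                  LinearMap.ker ((MvPolynomial.aeval fun p : MatIdx (k' + j) × MatIdx (k' + j) =>
                      ∑ l : MatIdx (k' + j), ((g⁻¹ : Matrix.GeneralLinearGroup (MatIdx (k' + j)) ℂ) :
                        Matrix (MatIdx (k' + j)) (MatIdx (k' + j)) ℂ) p.1 l •
                          (MvPolynomial.X (l, p.2) : MvPolynomial (MatIdx (k' + j) × MatIdx (k' + j)) ℂ)).toLinearMap -
                    weightChar ((Weight.dualOfPartition ((k' + j) * (k' + j)) (rowLift lam j)).toMatIdx : Weight (MatIdx (k' + j))) g •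
                      (LinearMap.id : MvPolynomial (MatIdx (k' + j) × MatIdx (k' + j)) ℂ →ₗ[ℂ] MvPolynomial (MatIdx (k' + j) × MatIdx (k' + j)) ℂ)))) <
      plethysmCoeff ℂ (MatIdx k') k' (partitionWeightLex k' lam)) :
    ∃ (U' : Submodule ℂ (MatIdx (k' + j) → ℂ)) (r' δ' : ℕ) (lam' : Nat.Partition ((k' + j) * δ')),
      (∀ u ∈ U', (Matrix.of fun a b : Fin (k' + j) => u (toLex (a, b))).rank ≤ r') ∧
        lam'.parts.card ≤ (k' + j) * (k' + j) ∧
          Module.finrank ℂ ↥(MvPolynomial.homogeneousSubmodule (MatIdx (k' + j) × MatIdx (k' + j)) ℂ ((k' + j) * δ') ⊓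
                ((MvPolynomial.vanishingIdeal ℂ
                    {p : MatIdx (k' + j) × MatIdx (k' + j) → ℂ | ∀ j' : MatIdx (k' + j), (fun i => p (j', i)) ∈ U'}) ^ (δ' * ((k' + j) - r'))).restrictScalars ℂ ⊓
                (⨅ (M : Matrix (MatIdx (k' + j)) (MatIdx (k' + j)) ℂ)
                  (_ : linSubst (MatIdx (k' + j)) ℂ M (detFormLex ℂ (k' + j)) = detFormLex ℂ (k' + j)),
                  LinearMap.ker ((MvPolynomial.aeval fun p : MatIdx (k' + j) × MatIdx (k' + j) =>
                      ∑ l : MatIdx (k' + j), M l p.2 •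
                        (MvPolynomial.X (p.1, l) : MvPolynomial (MatIdx (k' + j) × MatIdx (k' + j)) ℂ)).toLinearMap -
                    (LinearMap.id : MvPolynomial (MatIdx (k' + j) × MatIdx (k' + j)) ℂ →ₗ[ℂ] MvPolynomial (MatIdx (k' + j) × MatIdx (k' + j)) ℂ))) ⊓
                (⨅ (g : Matrix.GeneralLinearGroup (MatIdx (k' + j)) ℂ) (_ : IsUpperTriangular g),
                  LinearMap.ker ((MvPolynomial.aeval fun p : MatIdx (k' + j) × MatIdx (k' + j) =>
                      ∑ l : MatIdx (k' + j), ((g⁻¹ : Matrix.GeneralLinearGroup (MatIdx (k' + j)) ℂ) :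
                        Matrix (MatIdx (k' + j)) (MatIdx (k' + j)) ℂ) p.1 l •
                          (MvPolynomial.X (l, p.2) : MvPolynomial (MatIdx (k' + j) × MatIdx (k' + j)) ℂ)).toLinearMap -
                    weightChar ((Weight.dualOfPartition ((k' + j) * (k' + j)) lam').toMatIdx : Weight (MatIdx (k' + j))) g •
                      (LinearMap.id : MvPolynomial (MatIdx (k' + j) × MatIdx (k' + j)) ℂ →ₗ[ℂ] MvPolynomial (MatIdx (k' + j) × MatIdx (k' + j)) ℂ)))) <
            orbitMultiplicity ℂ (paddedPerFormLex ℂ N (k' + j)) (k' + j)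
              ((Weight.dualOfPartition ((k' + j) * (k' + j)) lam').toMatIdx : Weight (MatIdx (k' + j))) := by
  have hk1 : 1 ≤ k' * k' := Nat.one_le_iff_ne_zero.2 (mul_ne_zero (NeZero.ne k') (NeZero.ne k'))
  have hparts : (rowLift lam j).parts.card ≤ (k' + j) * (k' + j) :=
    ((card_parts_rowLift_le lam j).trans (max_le hlam hk1)).trans
      (Nat.mul_le_mul (Nat.le_add_right k' j) (Nat.le_add_right k' j))
  exact ⟨U, r, δ, rowLift lam j, hU, hparts, lt_of_lt_of_le hcensus
    (plethysmCoeff_le_orbitMultiplicity_paddedPer_rowLift j N hN₀ hN₀' hN lam hlam)⟩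

end

end Summit.ValiantsHypothesis.ValiantsHypothesis.Theorems.ValuativeFlip
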